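import Literature.AlgebraicGeometry.Limits.GenericFibreSpread
import Literature.AlgebraicGeometry.Resolution.SmoothLocusBaseChange
import Literature.AlgebraicGeometry.Resolution.BlowupsFlatBaseChange
import Literature.AlgebraicGeometry.Resolution.SmoothStalksRegular
import Mathlib.AlgebraicGeometry.Morphisms.Smooth
import Mathlib.AlgebraicGeometry.Noetherian
import Mathlib.RingTheory.RingHom.Flat
import HarnessLib

/-!
# Smoothness spreads out from the generic fibre

Topic: `Literature/AlgebraicGeometry/Resolution`. The smoothness instance of the spreading-out
principle (EGA IV₄ 17.7.8 / IV₃ 9.x in spirit; classical): let `A` be a domain with fraction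
field `K`, and `g : Z → Spec A` a morphism of finite presentation with `Z` a Noetherian scheme
(e.g. `A` Noetherian). If the generic fibre `Z_K → Spec K` is smooth, then `g` is smooth over a
non-empty basic open `D(b) ⊆ Spec A`, and consequently every fibre `Z ×_A Spec k → Spec k` at a
field-valued point `A → k` of `D(b)` is smooth, hence a regular scheme. All PROVED:

* `mem_smoothLocus_of_generic` — a point of the generic fibre which is a smooth point of
  `Z_K/K` maps to a smooth point of `Z/A`: the projection `Z_K → Z` is a flat preimmersion, so it
  induces isomorphisms of local rings (`isIso_stalkMap_of_flat_of_isPreimmersion`), and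
  `𝒪_{Spec A, η} → K` is an isomorphism likewise; Mathlib's `Scheme.Hom.smoothLocus` is defined
  through formal smoothness of the stalk maps;
* `exists_forall_mem_smoothLocus_of_smooth_generic` — **`g` is smooth over some `D(b)`,
  `b ≠ 0`**: the image of the (closed, constructible) non-smooth locus is constructible
  (Chevalley, via `Literature.AlgebraicGeometry.Limits.exists_basicOpen_disjoint_image`) and
  misses the generic point;
* `smooth_pullback_snd_of_forall_mem_smoothLocus`, `isRegular_pullback_of_forall_mem_smoothLocus`
  — the fibres at field-valued points of `D(b)` are smooth (`SmoothLocusBaseChange.lean`) and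
  regular (`SmoothStalksRegular.lean`, Stacks 056S).

## Sources

* A. Grothendieck, EGA IV₄ (1967), 17.7.8, 17.3.3; IV₃ (1966), 9.9 / 12.1 (spreading of
  smoothness from the generic fibre). [folklore]
* The Stacks Project, Tags 054K (Chevalley), 056S (smooth over a field ⇒ regular).
-/

noncomputable section

universe u

open CategoryTheory CategoryTheory.Limits AlgebraicGeometry TopologicalSpace PrimeSpectrum

namespace Literature.AlgebraicGeometry.Resolution

section Base

variable {A : Type u} [CommRing A] (K : Type u) [Field K] [Algebra A K] [IsFractionRing A K]

/-- `Spec K → Spec A` (`K` the fraction field) is flat. [folklore] -/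
theorem flat_specMap_fractionRing : Flat (Spec.map (CommRingCat.ofHom (algebraMap A K))) := by
  rw [Flat.SpecMap_iff]
  exact RingHom.flat_algebraMap_iff.mpr (IsLocalization.flat K (nonZeroDivisors A))

/-- `Spec K → Spec A` (`K` the fraction field) is a preimmersion. [folklore] -/
theorem isPreimmersion_specMap_fractionRing :
    IsPreimmersion (Spec.map (CommRingCat.ofHom (algebraMap A K))) :=
  IsPreimmersion.of_isLocalization (nonZeroDivisors A)

/-- The image of `Spec K → Spec A` is the generic point. [folklore] -/
theorem specMap_fractionRing_apply [IsDomain A] (x : Spec (CommRingCat.of K)) :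
    Spec.map (CommRingCat.ofHom (algebraMap A K)) x = (⊥ : PrimeSpectrum A) := by
  have hx : x.asIdeal = ⊥ := Ideal.eq_bot_of_prime x.asIdeal
  change PrimeSpectrum.comap (algebraMap A K) x = ⊥
  ext1
  rw [PrimeSpectrum.comap_asIdeal, hx, PrimeSpectrum.asIdeal_bot,
    Ideal.comap_bot_of_injective _ (IsFractionRing.injective A K)]

end Base

section Generic

variable {A : Type u} [CommRing A] [IsDomain A] (K : Type u) [Field K] [Algebra A K]
  [IsFractionRing A K] {Z : Scheme.{u}} (g : Z ⟶ Spec (CommRingCat.of A))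
  [LocallyOfFinitePresentation g]

omit [IsDomain A] in
/-- **A smooth point of the generic fibre `Z_K/K` maps to a smooth point of `Z/A`.** The
projection `Z_K = Z ×_A Spec K → Z` is a flat preimmersion and so induces isomorphisms on the
local rings, as does `Spec K → Spec A`; and the smooth locus is read off the stalk maps.
[folklore] -/
theorem mem_smoothLocus_of_generic
    (z' : ↑(pullback g (Spec.map (CommRingCat.ofHom (algebraMap A K)))))
    (hz' : z' ∈ (pullback.snd g (Spec.map (CommRingCat.ofHom (algebraMap A K)))).smoothLocus) :
    pullback.fst g (Spec.map (CommRingCat.ofHom (algebraMap A K))) z' ∈ g.smoothLocus := by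
  haveI := flat_specMap_fractionRing (A := A) K
  haveI := isPreimmersion_specMap_fractionRing (A := A) K
  rw [Scheme.Hom.mem_smoothLocus] at hz' ⊢
  haveI : IsIso ((pullback.fst g (Spec.map (CommRingCat.ofHom (algebraMap A K)))).stalkMap z') :=
    isIso_stalkMap_of_flat_of_isPreimmersion _ z'
  haveI : IsIso ((Spec.map (CommRingCat.ofHom (algebraMap A K))).stalkMap
      (pullback.snd g (Spec.map (CommRingCat.ofHom (algebraMap A K))) z')) :=
    isIso_stalkMap_of_flat_of_isPreimmersion _ _
  have h1 : ((pullback.fst g (Spec.map (CommRingCat.ofHom (algebraMap A K))) ≫ g).stalkMap z').hom.FormallySmooth ↔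
      (g.stalkMap (pullback.fst g (Spec.map (CommRingCat.ofHom (algebraMap A K))) z')).hom.FormallySmooth := by
    rw [Scheme.Hom.stalkMap_comp]
    exact RingHom.FormallySmooth.respectsIso.cancel_right_isIso _ _
  rw [← h1, pullback.condition, Scheme.Hom.stalkMap_comp]
  exact (RingHom.FormallySmooth.respectsIso.cancel_left_isIso _ _).mpr hz'

/-- **Smoothness spreads out from the generic fibre**: if `Z` is Noetherian, `g : Z → Spec A` is
of finite presentation and the generic fibre `Z_K → Spec K` is smooth, then there is `b ≠ 0` in
`A` such that every point of `Z` over `D(b)` is a smooth point of `g` (Chevalley applied to the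
non-smooth locus, which misses the generic fibre). [folklore] -/
theorem exists_forall_mem_smoothLocus_of_smooth_generic [QuasiCompact g] [IsNoetherian Z]
    (hK : Smooth (pullback.snd g (Spec.map (CommRingCat.ofHom (algebraMap A K))))) :
    ∃ b : A, b ≠ 0 ∧ ∀ z : Z, g z ∈ (basicOpen b : Set (PrimeSpectrum A)) → z ∈ g.smoothLocus := by
  -- the non-smooth locus is constructible (an open subset of a Noetherian space is compact)
  have hZc : Topology.IsConstructible ((g.smoothLocus : Set Z)ᶜ) :=
    ((NoetherianSpace.isCompact _).isConstructible g.smoothLocus.isOpen).compl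
  -- and its image misses the generic point
  have h0 : (⊥ : PrimeSpectrum A) ∉ g '' ((g.smoothLocus : Set Z)ᶜ) := by
    rintro ⟨z, hz, hzη⟩
    have hzr : z ∈ Set.range (pullback.fst g (Spec.map (CommRingCat.ofHom (algebraMap A K)))) := by
      rw [Scheme.Pullback.range_fst]
      change g z ∈ Set.range (Spec.map (CommRingCat.ofHom (algebraMap A K)))
      rw [hzη]
      let y : Spec (CommRingCat.of K) := ⟨⊥, Ideal.isPrime_bot⟩
      exact ⟨y, specMap_fractionRing_apply K y⟩
    obtain ⟨z', rfl⟩ := hzr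
    refine hz (mem_smoothLocus_of_generic K g z' ?_)
    haveI := hK
    rw [Scheme.Hom.smoothLocus_eq_top]
    trivial
  obtain ⟨b, hb0, hb⟩ :=
    Literature.AlgebraicGeometry.Limits.exists_basicOpen_disjoint_image g hZc h0
  refine ⟨b, hb0, fun z hz => ?_⟩
  by_contra hzs
  exact Set.disjoint_left.mp hb hz ⟨z, hzs, rfl⟩

end Generic

section Fibres

variable {A : Type u} [CommRing A] {Z : Scheme.{u}} (g : Z ⟶ Spec (CommRingCat.of A))
  [LocallyOfFinitePresentation g]

/-- **The fibres over the smooth locus are smooth**: if every point of `Z` over `D(b)` is a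
smooth point of `g`, then the fibre `Z ×_A Spec k → Spec k` at a field-valued point `φ : A → k`
with `φ b ≠ 0` is smooth (`SmoothLocusBaseChange.lean`). [folklore] -/
theorem smooth_pullback_snd_of_forall_mem_smoothLocus {b : A}
    (hb : ∀ z : Z, g z ∈ (basicOpen b : Set (PrimeSpectrum A)) → z ∈ g.smoothLocus)
    {k : Type u} [Field k] (φ : A →+* k) (hφ : φ b ≠ 0) :
    Smooth (pullback.snd g (Spec.map (CommRingCat.ofHom φ))) := by
  rw [← Scheme.Hom.smoothLocus_eq_top_iff]
  refine top_le_iff.mp fun p _ => ?_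
  apply Scheme.Hom.preimage_smoothLocus_le_smoothLocus_pullback_snd g (Spec.map (CommRingCat.ofHom φ))
  change pullback.fst g (Spec.map (CommRingCat.ofHom φ)) p ∈ g.smoothLocus
  apply hb
  rw [← Scheme.Hom.comp_apply, pullback.condition, Scheme.Hom.comp_apply]
  exact (Literature.AlgebraicGeometry.Limits.specMap_mem_basicOpen_iff φ b _).mpr hφ

/-- … and therefore a regular scheme (Stacks 056S, `SmoothStalksRegular.lean`).
[cite: StacksProject, Tag 056S] -/
theorem isRegular_pullback_of_forall_mem_smoothLocus {b : A}
    (hb : ∀ z : Z, g z ∈ (basicOpen b : Set (PrimeSpectrum A)) → z ∈ g.smoothLocus)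
    {k : Type u} [Field k] (φ : A →+* k) (hφ : φ b ≠ 0) :
    Scheme.IsRegular (pullback g (Spec.map (CommRingCat.ofHom φ))) := by
  haveI := smooth_pullback_snd_of_forall_mem_smoothLocus g hb φ hφ
  exact fun x => isRegularLocalRing_stalk_of_smooth_of_field
    (pullback.snd g (Spec.map (CommRingCat.ofHom φ))) x

end Fibres

end Literature.AlgebraicGeometry.Resolution

end
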